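/-
Copyright (c) 2026. All rights reserved.
Released under Apache 2.0 license as described in the file LICENSE.
-/
import Literature.AlgebraicGeometry.Pohlmann1968.MultiquadraticCMFieldPartiallyBentTypes
import HarnessLib

/-!
# Twist intersections `|Φ ∩ Φσ|` of a CM type of a multiquadratic CM field: the intrinsic form of the bent and
# partially-bent criteria, and of Carlet's bound

SETTING (tree `MultiquadraticCMFieldPartiallyBentTypes`, `…PlateauedTypes`, `AbelianCMFieldStabilizerCharacterCriterion`).
`K` a multiquadratic CM field (`[K:ℚ] = 2ᴺ`, `g = [K:ℚ]/2`), `Φ` a CM type (`|Φ| = g`), `Φσ = {φ ∘ σ : φ ∈ Φ}` its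
TWIST by `σ ∈ Gal(K/ℚ)` (tree `inducedCMType (σ.symm : K →+* K) Φ`), `Stab(Φ) = {σ : Φσ = Φ}` (tree
`twistStabilizer`), `Φρ = Φ̄`.  The tree states the autocorrelation counts of a CM type through a base embedding
`φ₀`: `c_σ(Φ) = #{s ∈ T_Φ : sσ ∈ T_Φ}`, `T_Φ = {s : φ₀ ∘ s⁻¹ ∈ Φ}`.  THIS FILE identifies them intrinsically and
restates the criteria of the tree in the classical language of twists:

> **Theorem** (`card_filter_mul_mem_eq_ncard_inter`, THE DICTIONARY).  **`c_σ(Φ) = |Φ ∩ Φσ|`** for every `σ`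
> (`σ_{sσ} = σ_s ∘ σ` for abelian `K`); `|Φ ∩ Φσ| = g ⟺ σ ∈ Stab(Φ)`, `|Φ ∩ Φσ| = 0 ⟺ σρ ∈ Stab(Φ)`.
> **Theorem** (`forall_sq_eq_iff_forall_ncard_inter`, BENT).  **`Φ` IS BENT IFF `|Φ ∩ Φσ| = g/2` FOR EVERY
> `σ ∉ {1, ρ}`** — every Galois twist other than `Φ, Φ̄` meets `Φ` in exactly half of its embeddings (Rothaus'
> «bent ⟺ all derivatives balanced», tree `forall_sq_eq_iff_forall_two_mul_card_eq`).
> **Theorem** (`partiallyBent_iff_forall_ncard_inter`, `forall_hodgeClassSpan_eq_iff_forall_ncard_inter`, THE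
> HEADLINE).  **`Φ` IS PARTIALLY-BENT IFF `|Φ ∩ Φσ| ∈ {0, g/2, g}` FOR EVERY `σ`; hence for a PLATEAUED `Φ` and any
> abelian variety `A` of type `(K; Φ)`: `Bᵐ(A) ⊗ ℂ = Dᵐ(A) ⊗ ℂ` for all `m` — and then the Hodge conjecture for every
> power `Aⁿ` — IFF EVERY GALOIS TWIST OF `Φ` MEETS `Φ` IN `0`, `g/2` OR `g` EMBEDDINGS**; for an arbitrary `Φ` the
> intersection condition alone already gives the Hodge conjecture for all powers
> (`hodgeConjectureFor_pow_of_forall_ncard_inter`).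
> **Theorem** (`finrank_le_card_filter_ncard_inter_mul`, Carlet's (6.35) intrinsically).  **`[K:ℚ] ≤ #{σ : |Φ ∩ Φσ| ≠ g/2}
> · (Rank(Φ) − 1)` for every CM type `Φ`, with equality iff every twist meets `Φ` in `0`, `g/2` or `g` embeddings.**

HONEST SCOPE.  A dictionary file: every statement is the tree's group-level theorem rewritten through
`c_σ(Φ) = |Φ ∩ Φσ|`; the sources print the Boolean-function statements (Carlet) and the twist formalism (Shimura,
Bouw et al.); the phrasing by twist intersections is this file's.  THEOREMS ONLY: no definition, no named fact, no
instance, no `sorry`.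

## References

* [Carlet2020] C. Carlet, *Boolean Functions for Cryptography and Coding Theory*, CUP (2020), §6.1.6 (bent ⟺
  balanced derivatives), §6.2.1 Proposition 94, Definition 62.
* [Carlet1993] C. Carlet, *Partially-bent functions*, Des. Codes Cryptogr. 3 (1993) 135–145.
* [Shimura1998] G. Shimura, *Abelian Varieties with Complex Multiplication and Modular Functions*, §8.1–8.2, §32.10.
* [BCLLMNO2015] I. Bouw et al., §3 Prop. 3.3 (the stabiliser `{h : Φh = Φ}`).
* [Gordon1999HodgeAVSurvey] B. B. Gordon, *A survey of the Hodge conjecture for abelian varieties*, Thm. 6.4, §9.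
* [Pohlmann1968] H. Pohlmann, *Algebraic cycles on abelian varieties of complex multiplication type*, Thm. 1.
* [Kubota1965] T. Kubota, *On the field extension by complex multiplication*, §4 Lemma 2.

## Provenance

Lane `lit-hodgefound` (Track 2, Layer A3), seat `lit-hodgefound-p10` generation 43, row g43-#12; neighbours cited by
name, nothing restated: `MultiquadraticCMFieldPartiallyBentTypes` (g43-#10: `forall_hodgeClassSpan_eq_iff_partiallyBent`,
`hodgeConjectureFor_pow_of_partiallyBent`, `finrank_le_card_filter_mul`, `card_filter_mul_eq_iff_partiallyBent`, USED),
`DegenerateCMTypesElementaryAbelianPartiallyBentTypes` (`card_filter_eq_card_iff`, `card_filter_eq_zero_iff`, USED),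
`DegenerateCMTypesElementaryAbelianBentTypes` (`forall_sq_eq_iff_forall_two_mul_card_eq`, USED),
`AbelianCMFieldStabilizerCharacterCriterion` (`embOf_inv_mul`, `mem_twistStabilizer_iff_forall_mul_mem_iff`, USED),
`CMTypeRankCharactersNumberField` (`embOf_bijective`), `InducedCMType` (`mem_inducedCMType_iff`),
`Motives/HodgeStructureOfCMType` (`two_mul_ncard_cmType_eq_finrank`), `DegenerateCMTypesCyclicCMFieldTwoOddPrimes`
(`isCMTypeWith_galType`), `NondegenerateCMTypeExistenceAbelianField` (`apply_conjGal_eq`),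
`SimpleDegenerateCMAbelianVarietiesCompositeDimension` (`card_gal_eq_finrank`).
-/

open scoped BigOperators NumberField IsMulCommutative Classical
open NumberField Module CategoryTheory CategoryTheory.Limits IntermediateField

namespace Literature.AlgebraicGeometry.Pohlmann1968

namespace MultiquadraticTwistIntersections

open scoped Literature.NumberTheory.ComplexMultiplication
open Literature.NumberTheory.ComplexMultiplication (twistStabilizer typeRank IsCMTypeWith conjGal inducedCMType
  mem_inducedCMType_iff)
open Literature.NumberTheory.ComplexMultiplication.CyclicCMType.ExponentTwo.PartiallyBentTypes
  (card_filter_eq_card_iff card_filter_eq_zero_iff)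
open Literature.NumberTheory.ComplexMultiplication.CyclicCMType.ExponentTwo.BentTypes
  (forall_sq_eq_iff_forall_two_mul_card_eq)
open Literature.AlgebraicGeometry.Pohlmann1968.CyclicTwoOddPrimes (isCMTypeWith_galType)
open Literature.AlgebraicGeometry.Pohlmann1968.MultiquadraticPartiallyBent (forall_hodgeClassSpan_eq_iff_partiallyBent
  hodgeConjectureFor_pow_of_partiallyBent finrank_le_card_filter_mul card_filter_mul_eq_iff_partiallyBent)
open Literature.AlgebraicGeometry.Motives (CMType AbelianVariety)
open Literature.AlgebraicGeometry.HodgeTheory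
open Literature.AlgebraicGeometry.VanGeemen1994 (hodgeClassSpan)
open Literature.Barriers.HodgeConjecture (divisorClassesSpan)
open Literature.AlgebraicGeometry.ComplexMultiplication (IsCMTypeRealisation)

variable {K : Type} [Field K] [NumberField K] [IsCMField K] [IsGalois ℚ K]
  {A : AbelianVariety ℂ} {ι : 𝓞 K →+* End A} {θ : K →+* Module.End ℂ (complexBetti A.X 1)} {L : ℕ}

/-! ## §0 Dictionary helpers -/

section Helpers

omit [IsGalois ℚ K] in
/-- `σ_{ρg} = σ̄_g` under the base embedding. [cite: Shimura1998, §18.2 Lemma (i)] -/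
private theorem apply_conjGal_eq_ti (φ₀ : K →+* ℂ) (x : K) :
    φ₀ ((conjGal : K ≃ₐ[ℚ] K) x) = starRingEnd ℂ (φ₀ x) :=
  AbelianCMFieldExistence.apply_conjGal_eq φ₀ x

/-- The group-level type `T_Φ` is a CM type of `Gal(K/ℚ)` w.r.t. `ρ`. [cite: Shimura1998, §8.1] -/
private theorem isCMTypeWith_T_ti (hexp : ∀ g : K ≃ₐ[ℚ] K, g ^ 2 = 1) (φ₀ : K →+* ℂ) (Φ : CMType K) :
    IsCMTypeWith (conjGal : K ≃ₐ[ℚ] K)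
      (↑(Finset.univ.filter fun s : K ≃ₐ[ℚ] K => embOf φ₀ s ∈ Φ.1) : Set (K ≃ₐ[ℚ] K)) := by
  haveI := Multiquadratic.isAbelianGalois_of_forall_sq_eq_one hexp
  exact isCMTypeWith_galType (apply_conjGal_eq_ti φ₀) Φ

omit [IsCMField K] [IsGalois ℚ K] in
/-- `|Φ| = g = [K:ℚ]/2`. [cite: Shimura1998, §8.1] -/
private theorem ncard_eq_ti (Φ : CMType K) : Φ.1.ncard = finrank ℚ K / 2 := by
  have := Literature.AlgebraicGeometry.Motives.HodgeStructure.two_mul_ncard_cmType_eq_finrank Φ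
  omega

omit [IsCMField K] in
/-- `|T_Φ| = |Φ|`. [cite: Shimura1998, §8.1] -/
private theorem card_T_eq_ncard_ti (φ₀ : K →+* ℂ) (Φ : CMType K) :
    (Finset.univ.filter fun s : K ≃ₐ[ℚ] K => embOf φ₀ s ∈ Φ.1).card = Φ.1.ncard := by
  rw [← Set.ncard_coe_finset]
  have himg : (embOf φ₀) '' (↑(Finset.univ.filter fun s : K ≃ₐ[ℚ] K => embOf φ₀ s ∈ Φ.1) : Set (K ≃ₐ[ℚ] K)) =
      Φ.1 := by
    ext φ
    simp only [Set.mem_image, Finset.coe_filter, Finset.mem_univ, true_and, Set.mem_setOf_eq]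
    constructor
    · rintro ⟨s, hs, rfl⟩
      exact hs
    · intro hφ
      obtain ⟨s, rfl⟩ := (embOf_bijective φ₀).2 φ
      exact ⟨s, hφ, rfl⟩
  have h2 := Set.ncard_image_of_injective
    (↑(Finset.univ.filter fun s : K ≃ₐ[ℚ] K => embOf φ₀ s ∈ Φ.1) : Set (K ≃ₐ[ℚ] K)) (embOf_bijective φ₀).1
  rw [himg] at h2
  exact h2.symm

omit [IsCMField K] in
/-- **`σ_{sσ} = σ_s ∘ σ`** for abelian `Gal(K/ℚ)` (`σ_s = φ₀ ∘ s⁻¹`; tree `embOf_inv_mul`: `σ_{σ⁻¹s} = σ_s ∘ σ`).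
[cite: Shimura1998, §8.1] -/
private theorem embOf_mul_eq_comp_ti (hexp : ∀ g : K ≃ₐ[ℚ] K, g ^ 2 = 1) (φ₀ : K →+* ℂ) (s σ : K ≃ₐ[ℚ] K) :
    embOf φ₀ (s * σ) = (embOf φ₀ s).comp (σ.symm : K →+* K) := by
  haveI := Multiquadratic.isAbelianGalois_of_forall_sq_eq_one hexp
  have h := embOf_inv_mul φ₀ σ⁻¹ s
  rw [inv_inv, mul_comm] at h
  rw [h, AlgEquiv.aut_inv]

omit [IsCMField K] in
/-- **`sσ ∈ T_Φ ⟺ σ_s ∈ Φσ`** (`Φσ = {φ : φ ∘ σ⁻¹ ∈ Φ}`, tree `inducedCMType σ.symm`). [cite: Shimura1998, §8.2]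
[cite: BCLLMNO2015, §3 Prop. 3.3] -/
private theorem mul_mem_T_iff_ti (hexp : ∀ g : K ≃ₐ[ℚ] K, g ^ 2 = 1) (φ₀ : K →+* ℂ) (Φ : CMType K)
    (s σ : K ≃ₐ[ℚ] K) :
    s * σ ∈ (Finset.univ.filter fun s : K ≃ₐ[ℚ] K => embOf φ₀ s ∈ Φ.1) ↔
      embOf φ₀ s ∈ (inducedCMType (σ.symm : K →+* K) Φ).1 := by
  rw [Finset.mem_filter, mem_inducedCMType_iff, embOf_mul_eq_comp_ti hexp]
  simp only [Finset.mem_univ, true_and]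

omit [IsCMField K] [IsGalois ℚ K] in
/-- A number field has a complex embedding. [folklore] -/
private theorem nonempty_emb_ti : Nonempty (K →+* ℂ) := by
  have h : 0 < Fintype.card (K →+* ℂ) := by rw [NumberField.Embeddings.card K ℂ]; exact finrank_pos
  exact Fintype.card_pos_iff.1 h

end Helpers

/-! ## §1 The dictionary `c_σ(Φ) = |Φ ∩ Φσ|` -/

section Dictionary

omit [IsCMField K] in
/-- **`c_σ(Φ) = |Φ ∩ Φσ|`**: the autocorrelation count `#{s ∈ T_Φ : sσ ∈ T_Φ}` of the tree is the number of
embeddings of `Φ` lying in the twist `Φσ` (abelian `K`; `s ↦ σ_s` is a bijection `Gal(K/ℚ) → Hom(K, ℂ)`).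
[cite: Shimura1998, §8.1–8.2] [cite: BCLLMNO2015, §3 Prop. 3.3] [cite: Carlet2020, §6.2.1 Proposition 94] -/
theorem card_filter_mul_mem_eq_ncard_inter (hexp : ∀ g : K ≃ₐ[ℚ] K, g ^ 2 = 1) (φ₀ : K →+* ℂ) (Φ : CMType K)
    (σ : K ≃ₐ[ℚ] K) :
    ((Finset.univ.filter fun s : K ≃ₐ[ℚ] K => embOf φ₀ s ∈ Φ.1).filter fun t =>
        t * σ ∈ (Finset.univ.filter fun s : K ≃ₐ[ℚ] K => embOf φ₀ s ∈ Φ.1)).card =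
      (Φ.1 ∩ (inducedCMType (σ.symm : K →+* K) Φ).1).ncard := by
  rw [← Set.ncard_coe_finset]
  have himg : (embOf φ₀) '' (↑((Finset.univ.filter fun s : K ≃ₐ[ℚ] K => embOf φ₀ s ∈ Φ.1).filter fun t =>
      t * σ ∈ (Finset.univ.filter fun s : K ≃ₐ[ℚ] K => embOf φ₀ s ∈ Φ.1)) : Set (K ≃ₐ[ℚ] K)) =
      Φ.1 ∩ (inducedCMType (σ.symm : K →+* K) Φ).1 := by
    ext φ
    simp only [Set.mem_image, Finset.coe_filter, Set.mem_setOf_eq, Set.mem_inter_iff]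
    constructor
    · rintro ⟨s, ⟨hs, hsσ⟩, rfl⟩
      exact ⟨(Finset.mem_filter.1 hs).2, (mul_mem_T_iff_ti hexp φ₀ Φ s σ).1 hsσ⟩
    · rintro ⟨hφ, hφσ⟩
      obtain ⟨s, rfl⟩ := (embOf_bijective φ₀).2 φ
      exact ⟨s, ⟨Finset.mem_filter.2 ⟨Finset.mem_univ _, hφ⟩, (mul_mem_T_iff_ti hexp φ₀ Φ s σ).2 hφσ⟩, rfl⟩
  rw [← himg, Set.ncard_image_of_injective _ (embOf_bijective φ₀).1]

omit [IsCMField K] in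
/-- **`|Φ ∩ Φσ| = g ⟺ σ ∈ Stab(Φ)`** (`Φσ = Φ`). [cite: BCLLMNO2015, §3 Prop. 3.3] [cite: Shimura1998, §8.2] -/
theorem ncard_inter_eq_iff_mem_twistStabilizer (hexp : ∀ g : K ≃ₐ[ℚ] K, g ^ 2 = 1) (Φ : CMType K)
    (σ : K ≃ₐ[ℚ] K) :
    (Φ.1 ∩ (inducedCMType (σ.symm : K →+* K) Φ).1).ncard = finrank ℚ K / 2 ↔ σ ∈ twistStabilizer Φ := by
  haveI := Multiquadratic.isAbelianGalois_of_forall_sq_eq_one hexp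
  obtain ⟨φ₀⟩ := nonempty_emb_ti (K := K)
  rw [← card_filter_mul_mem_eq_ncard_inter hexp φ₀ Φ σ, ← ncard_eq_ti Φ, ← card_T_eq_ncard_ti φ₀ Φ,
    card_filter_eq_card_iff hexp, mem_twistStabilizer_iff_forall_mul_mem_iff φ₀ Φ σ]

/-- **`|Φ ∩ Φσ| = 0 ⟺ σρ ∈ Stab(Φ)`** (`Φσ = Φ̄`). [cite: BCLLMNO2015, §3 Prop. 3.3] [cite: Shimura1998, §8.2] -/
theorem ncard_inter_eq_zero_iff_mul_conjGal_mem (hexp : ∀ g : K ≃ₐ[ℚ] K, g ^ 2 = 1) (Φ : CMType K)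
    (σ : K ≃ₐ[ℚ] K) :
    (Φ.1 ∩ (inducedCMType (σ.symm : K →+* K) Φ).1).ncard = 0 ↔
      σ * (conjGal : K ≃ₐ[ℚ] K) ∈ twistStabilizer Φ := by
  haveI := Multiquadratic.isAbelianGalois_of_forall_sq_eq_one hexp
  obtain ⟨φ₀⟩ := nonempty_emb_ti (K := K)
  rw [← card_filter_mul_mem_eq_ncard_inter hexp φ₀ Φ σ, card_filter_eq_zero_iff hexp (isCMTypeWith_T_ti hexp φ₀ Φ),
    mem_twistStabilizer_iff_forall_mul_mem_iff φ₀ Φ, mul_comm σ]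

end Dictionary

/-! ## §2 Bent and partially-bent, intrinsically -/

section Criteria

/-- **`Φ` IS BENT IFF EVERY GALOIS TWIST `Φσ ∉ {Φ, Φ̄}`… more precisely every `σ ∉ {1, ρ}` — MEETS `Φ` IN EXACTLY
`g/2` EMBEDDINGS**: `Ŝ(χ)² = g` for all odd `χ` iff `2|Φ ∩ Φσ| = g` for all `σ ≠ 1, ρ` (Rothaus: bent ⟺ all
derivatives balanced; tree `forall_sq_eq_iff_forall_two_mul_card_eq`). [cite: Carlet2020, §6.1.6]
[cite: Kubota1965, §4 Lemma 2] [cite: Shimura1998, §8.2] -/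
theorem forall_sq_eq_iff_forall_ncard_inter (hexp : ∀ g : K ≃ₐ[ℚ] K, g ^ 2 = 1) (φ₀ : K →+* ℂ) (Φ : CMType K) :
    (∀ χ : AddChar (Additive (K ≃ₐ[ℚ] K)) ℂ, χ (Additive.ofMul (conjGal : K ≃ₐ[ℚ] K)) = -1 →
      (∑ s ∈ (Finset.univ.filter fun s : K ≃ₐ[ℚ] K => embOf φ₀ s ∈ Φ.1), χ (Additive.ofMul s)) ^ 2 =
        ((Finset.univ.filter fun s : K ≃ₐ[ℚ] K => embOf φ₀ s ∈ Φ.1).card : ℂ)) ↔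
    ∀ σ : K ≃ₐ[ℚ] K, σ ≠ 1 → σ ≠ conjGal →
      2 * (Φ.1 ∩ (inducedCMType (σ.symm : K →+* K) Φ).1).ncard = finrank ℚ K / 2 := by
  haveI := Multiquadratic.isAbelianGalois_of_forall_sq_eq_one hexp
  rw [forall_sq_eq_iff_forall_two_mul_card_eq hexp (isCMTypeWith_T_ti hexp φ₀ Φ)]
  refine forall_congr' fun σ => forall_congr' fun _ => forall_congr' fun _ => ?_
  rw [card_filter_mul_mem_eq_ncard_inter hexp φ₀ Φ σ, card_T_eq_ncard_ti φ₀ Φ, ncard_eq_ti Φ]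

omit [IsCMField K] in
/-- **`Φ` IS PARTIALLY-BENT IFF `|Φ ∩ Φσ| ∈ {0, g/2, g}` FOR EVERY `σ ∈ Gal(K/ℚ)`** (the tree's group-level predicate
`c_σ ∈ {0, g/2, g}` rewritten through the dictionary). [cite: Carlet2020, §6.2.1 Definition 62] [cite: Shimura1998, §8.2] -/
theorem partiallyBent_iff_forall_ncard_inter (hexp : ∀ g : K ≃ₐ[ℚ] K, g ^ 2 = 1) (φ₀ : K →+* ℂ) (Φ : CMType K) :
    (∀ g : K ≃ₐ[ℚ] K,
      (((Finset.univ.filter fun s : K ≃ₐ[ℚ] K => embOf φ₀ s ∈ Φ.1).filter fun t =>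
          t * g ∈ (Finset.univ.filter fun s : K ≃ₐ[ℚ] K => embOf φ₀ s ∈ Φ.1)).card = 0 ∨
        ((Finset.univ.filter fun s : K ≃ₐ[ℚ] K => embOf φ₀ s ∈ Φ.1).filter fun t =>
          t * g ∈ (Finset.univ.filter fun s : K ≃ₐ[ℚ] K => embOf φ₀ s ∈ Φ.1)).card =
          (Finset.univ.filter fun s : K ≃ₐ[ℚ] K => embOf φ₀ s ∈ Φ.1).card) ∨
      2 * ((Finset.univ.filter fun s : K ≃ₐ[ℚ] K => embOf φ₀ s ∈ Φ.1).filter fun t =>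
          t * g ∈ (Finset.univ.filter fun s : K ≃ₐ[ℚ] K => embOf φ₀ s ∈ Φ.1)).card =
        (Finset.univ.filter fun s : K ≃ₐ[ℚ] K => embOf φ₀ s ∈ Φ.1).card) ↔
    ∀ σ : K ≃ₐ[ℚ] K,
      ((Φ.1 ∩ (inducedCMType (σ.symm : K →+* K) Φ).1).ncard = 0 ∨
        (Φ.1 ∩ (inducedCMType (σ.symm : K →+* K) Φ).1).ncard = finrank ℚ K / 2) ∨
      2 * (Φ.1 ∩ (inducedCMType (σ.symm : K →+* K) Φ).1).ncard = finrank ℚ K / 2 := by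
  refine forall_congr' fun σ => ?_
  rw [card_filter_mul_mem_eq_ncard_inter hexp φ₀ Φ σ, card_T_eq_ncard_ti φ₀ Φ, ncard_eq_ti Φ]

end Criteria

/-! ## §3 The Hodge dictionary, intrinsically -/

section Hodge

/-- **EVERY TWIST MEETS `Φ` IN `0`, `g/2` OR `g` EMBEDDINGS ⟹ THE HODGE CONJECTURE FOR EVERY POWER** of every
abelian variety `A` of type `(K; Φ)` (and `Bᵐ(A) ⊗ ℂ = Dᵐ(A) ⊗ ℂ` for all `m`): such `Φ` is partially-bent, hence
attains Shimura's reflex bound. [cite: Gordon1999HodgeAVSurvey, Thm. 6.4 and §9.3] [cite: Pohlmann1968, Thm. 1]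
[cite: Carlet2020, §6.2.1 Definition 62] -/
theorem hodgeConjectureFor_pow_of_forall_ncard_inter (hexp : ∀ g : K ≃ₐ[ℚ] K, g ^ 2 = 1) (Φ : CMType K)
    (hpb : ∀ σ : K ≃ₐ[ℚ] K,
      ((Φ.1 ∩ (inducedCMType (σ.symm : K →+* K) Φ).1).ncard = 0 ∨
        (Φ.1 ∩ (inducedCMType (σ.symm : K →+* K) Φ).1).ncard = finrank ℚ K / 2) ∨
      2 * (Φ.1 ∩ (inducedCMType (σ.symm : K →+* K) Φ).1).ncard = finrank ℚ K / 2)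
    (hA : IsCMTypeRealisation Φ A ι θ) :
    (∀ m : ℕ, hodgeClassSpan (finrank ℚ K / 2) A.X m = divisorClassesSpan A.X (finrank ℚ K / 2) m) ∧
      ∀ n : ℕ, HodgeConjectureFor (⨁ fun _ : Fin n => A).dim (⨁ fun _ : Fin n => A).X := by
  obtain ⟨φ₀⟩ := nonempty_emb_ti (K := K)
  exact hodgeConjectureFor_pow_of_partiallyBent hexp φ₀ Φ ((partiallyBent_iff_forall_ncard_inter hexp φ₀ Φ).2 hpb) hA

/-- **THE HEADLINE, INTRINSICALLY.**  For a PLATEAUED CM type `Φ` of a multiquadratic CM field (`Ŝ(χ)² ∈ {0, L}` on the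
odd characters) and any abelian variety `A` of type `(K; Φ)`: **`Bᵐ(A) ⊗ ℂ = Dᵐ(A) ⊗ ℂ` FOR ALL `m` IFF EVERY GALOIS
TWIST `Φσ` MEETS `Φ` IN `0`, `g/2` OR `g` EMBEDDINGS.** [cite: Gordon1999HodgeAVSurvey, Thm. 6.4] [cite: Pohlmann1968, Thm. 1]
[cite: Carlet2020, §6.2.1 Proposition 94 and Definition 62] [cite: Shimura1998, §32.10] -/
theorem forall_hodgeClassSpan_eq_iff_forall_ncard_inter (hexp : ∀ g : K ≃ₐ[ℚ] K, g ^ 2 = 1) (φ₀ : K →+* ℂ)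
    (Φ : CMType K)
    (hpl : ∀ χ : AddChar (Additive (K ≃ₐ[ℚ] K)) ℂ, χ (Additive.ofMul (conjGal : K ≃ₐ[ℚ] K)) = -1 →
      ∑ s ∈ (Finset.univ.filter fun s : K ≃ₐ[ℚ] K => embOf φ₀ s ∈ Φ.1), χ (Additive.ofMul s) = 0 ∨
        (∑ s ∈ (Finset.univ.filter fun s : K ≃ₐ[ℚ] K => embOf φ₀ s ∈ Φ.1), χ (Additive.ofMul s)) ^ 2 = (L : ℂ))
    (hA : IsCMTypeRealisation Φ A ι θ) :
    (∀ m : ℕ, hodgeClassSpan (finrank ℚ K / 2) A.X m = divisorClassesSpan A.X (finrank ℚ K / 2) m) ↔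
      ∀ σ : K ≃ₐ[ℚ] K,
        ((Φ.1 ∩ (inducedCMType (σ.symm : K →+* K) Φ).1).ncard = 0 ∨
          (Φ.1 ∩ (inducedCMType (σ.symm : K →+* K) Φ).1).ncard = finrank ℚ K / 2) ∨
        2 * (Φ.1 ∩ (inducedCMType (σ.symm : K →+* K) Φ).1).ncard = finrank ℚ K / 2 := by
  rw [forall_hodgeClassSpan_eq_iff_partiallyBent hexp φ₀ Φ hpl hA, partiallyBent_iff_forall_ncard_inter hexp φ₀ Φ]

end Hodge

/-! ## §4 Carlet's bound (6.35), intrinsically -/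

section Prop94

omit [IsCMField K] in
/-- The set `{σ : 2c_σ ≠ g}` is `{σ : 2|Φ ∩ Φσ| ≠ g}`. [cite: Carlet2020, §6.2.1 Proposition 94] -/
private theorem filter_eq_ti (hexp : ∀ g : K ≃ₐ[ℚ] K, g ^ 2 = 1) (φ₀ : K →+* ℂ) (Φ : CMType K) :
    (Finset.univ.filter fun g : K ≃ₐ[ℚ] K =>
        2 * ((Finset.univ.filter fun s : K ≃ₐ[ℚ] K => embOf φ₀ s ∈ Φ.1).filter fun t =>
          t * g ∈ (Finset.univ.filter fun s : K ≃ₐ[ℚ] K => embOf φ₀ s ∈ Φ.1)).card ≠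
          (Finset.univ.filter fun s : K ≃ₐ[ℚ] K => embOf φ₀ s ∈ Φ.1).card) =
      Finset.univ.filter fun σ : K ≃ₐ[ℚ] K =>
        2 * (Φ.1 ∩ (inducedCMType (σ.symm : K →+* K) Φ).1).ncard ≠ finrank ℚ K / 2 := by
  refine Finset.filter_congr fun σ _ => ?_
  rw [card_filter_mul_mem_eq_ncard_inter hexp φ₀ Φ σ, card_T_eq_ncard_ti φ₀ Φ, ncard_eq_ti Φ]

/-- **CARLET'S BOUND FOR CM TYPES OF A MULTIQUADRATIC CM FIELD: `[K:ℚ] ≤ #{σ : |Φ ∩ Φσ| ≠ g/2} · (Rank(Φ) − 1)`**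
(`2ⁿ ≤ N_{Δ_f}·N_{W_f}`; the twists meeting `Φ` in other than half of its embeddings are the «unbalanced
derivatives»). [cite: Carlet2020, §6.2.1 Proposition 94] [cite: Kubota1965, §4 Lemma 2] -/
theorem finrank_le_card_filter_ncard_inter_mul (hexp : ∀ g : K ≃ₐ[ℚ] K, g ^ 2 = 1) (Φ : CMType K) :
    finrank ℚ K ≤ (Finset.univ.filter fun σ : K ≃ₐ[ℚ] K =>
        2 * (Φ.1 ∩ (inducedCMType (σ.symm : K →+* K) Φ).1).ncard ≠ finrank ℚ K / 2).card * (cmTypeRank Φ - 1) := by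
  obtain ⟨φ₀⟩ := nonempty_emb_ti (K := K)
  rw [← filter_eq_ti hexp φ₀ Φ]
  exact finrank_le_card_filter_mul hexp φ₀ Φ

/-- **EQUALITY IN CARLET'S BOUND IFF EVERY TWIST MEETS `Φ` IN `0`, `g/2` OR `g` EMBEDDINGS** (iff `Φ` is
partially-bent). [cite: Carlet2020, §6.2.1 Proposition 94 and Definition 62] [cite: Kubota1965, §4 Lemma 2] -/
theorem card_filter_ncard_inter_mul_eq_iff (hexp : ∀ g : K ≃ₐ[ℚ] K, g ^ 2 = 1) (Φ : CMType K) :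
    (Finset.univ.filter fun σ : K ≃ₐ[ℚ] K =>
        2 * (Φ.1 ∩ (inducedCMType (σ.symm : K →+* K) Φ).1).ncard ≠ finrank ℚ K / 2).card * (cmTypeRank Φ - 1) =
        finrank ℚ K ↔
      ∀ σ : K ≃ₐ[ℚ] K,
        ((Φ.1 ∩ (inducedCMType (σ.symm : K →+* K) Φ).1).ncard = 0 ∨
          (Φ.1 ∩ (inducedCMType (σ.symm : K →+* K) Φ).1).ncard = finrank ℚ K / 2) ∨
        2 * (Φ.1 ∩ (inducedCMType (σ.symm : K →+* K) Φ).1).ncard = finrank ℚ K / 2 := by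
  obtain ⟨φ₀⟩ := nonempty_emb_ti (K := K)
  rw [← filter_eq_ti hexp φ₀ Φ, card_filter_mul_eq_iff_partiallyBent hexp φ₀ Φ, partiallyBent_iff_forall_ncard_inter hexp φ₀ Φ]

end Prop94

end MultiquadraticTwistIntersections

end Literature.AlgebraicGeometry.Pohlmann1968
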